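import Literature.Computability.Cryptography.PRGStretchExtensionReduction
import Literature.Computability.Cryptography.IndistinguishabilityRepeatedIndexed
import HarnessLib

/-!
# Stretch extension for indexed, level-structured candidate generators (Goldreich 2001, Thm. 3.3.3, indexed form)

Topic `Literature/Computability/Cryptography`. `PRGStretchExtension(Reduction).lean` prove Goldreich's
Thm. 3.3.3 (Construction 3.3.2: iterate a one-bit-stretch generator) for ONE polynomial-time `G₁` defined on
all seed lengths. The enumeration step of Håstad–Impagliazzo–Levin–Luby's construction of pseudorandom
generators (HILL 1999, §4; Haitner–Reingold–Vadhan 2013, §1.1 "Enumeration": "construct a pseudorandom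
generator `G_k` for each [guess `k`], *each stretched enough*, and XOR them") needs the same theorem for a
polynomial family of *candidates*, only one of which — at an unknown, level-dependent and possibly
non-computable index `k₀(n)` — is pseudorandom, and all of which live on one seed length `a(n)` per level
`n`: the format of `IndistinguishabilityRepeatedIndexed.lean` / `XorCombiner.lean`, an `FP` sampler `S` read
as `G^{(n,i)}(s) = S(⟨1ⁿ, ⟨1ⁱ, s⟩⟩)`, `|s| = a(n)`, `|G^{(n,i)}(s)| = a(n) + 1` (`HasOutLenI S a (a+1)`).

This file proves that indexed form:

* `PRGStretchI.G1 S n i` — the candidate one-step map, clamped to growth exactly one bit on every string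
  (so that Construction 3.3.2 and its bookkeeping `PRGStretch.gen/st` apply verbatim), equal to
  `G^{(n,i)}` on `a(n)`-bit seeds (`G1_eq_of_length`);
* `PRGStretchI.genI S Lp` — **the stretched indexed sampler**: `⟨1ⁿ, ⟨1ⁱ, s⟩⟩ ↦ PRGStretch.gen (G1 S n i) (Lp n) s`
  (Construction 3.3.2 at level `n` with `Lp(n)` rounds), in `FP` (`genI_mem_FP`: a clocked loop carrying the
  context `⟨1ⁿ, 1ⁱ⟩`), of common output length `Lp(n)` (`hasOutLenI_genI`);
* `PRGStretchI.redI` — the reduction `D'` of the printed proof with THREE pieces of advice in its coin count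
  (hybrid position `k`, candidate index `i = k₀(n)`, coin count of `D`; decoded by two unary `divMod`s),
  `isPPT_redI`, and its laws `acceptPMF_redI_map` / `acceptPMF_redI_uniform` (Claims 3.3.3.1–2 as `PMF`
  identities on the hybrids `PRGStretch.hyb (G1 S n i) (a n) (Lp n) k`);
* **`isPseudorandom_genI`** — if `n ↦ G^{(n,k₀(n))}(U_{a(n)})` is pseudorandom (against `U_{a(n)+1}`) for
  some polynomially bounded index sequence `k₀`, then `n ↦ genI⟨1ⁿ, ⟨1^{k₀(n)}, U_{a(n)}⟩⟩` is pseudorandom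
  against `U_{Lp(n)}`: `Δ(n) ≤ Lp(n) · adv_{D'}(n)` at every `n` (`distAdvantage_le_mul_redI`).

All statements proved; no named facts. (Consumed by the false-entropy construction of a pseudorandom
generator from a bit-commitment scheme, where the candidates are indexed by the entropy guess.)

## References

* O. Goldreich, *Foundations of Cryptography I: Basic Tools*, CUP 2001: §3.3.2, Construction 3.3.2 and
  Thm. 3.3.3 with its proof (Claims 3.3.3.1–3.3.3.2; PDF pp. 146–149 of the 2004 printing).
* J. Håstad, R. Impagliazzo, L. A. Levin, M. Luby, *A pseudorandom generator from any one-way function*,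
  SIAM J. Comput. 28 (1999) 1364–1396, §4 (candidate generators stretched and XOR-ed).
* I. Haitner, O. Reingold, S. Vadhan, *Efficiency improvements in constructing pseudorandom generators from
  one-way functions*, SIAM J. Comput. 42 (2013), §1.1 ("Enumeration").
* S. Arora, B. Barak, *Computational Complexity: A Modern Approach*, CUP 2009: §1.3–1.4, Def. 7.1 (toolkit).
-/

namespace Literature.Computability.Cryptography

open Filter Asymptotics _root_.Computability Complexity Complexity.Brick MetaComplexity PRGTrunc
  Polynomial Finset PRGStretch RepSampI

namespace PRGStretchI

variable (S : List Bool → List Bool)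

/-! ### The clamped one-step candidate -/

/-- **The one-step candidate at level `n`, index `i`**, clamped to growth exactly one bit:
`G1 S n i t = (S⟨1ⁿ, ⟨1ⁱ, t⟩⟩ · 1 · t) ↾ (|t| + 1)` (equal to `S⟨1ⁿ, ⟨1ⁱ, t⟩⟩` whenever that string has
length `|t| + 1`). [cite: Goldreich2001, Construction 3.3.2 (the one-bit-stretch `G₁`)] -/
def G1 (n i : ℕ) (t : List Bool) : List Bool :=
  (atLevelI S n i t ++ (true :: t)).take (t.length + 1)

/-- `|G1 S n i t| = |t| + 1` on every string. [folklore] -/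
theorem length_G1 (n i : ℕ) (t : List Bool) : (G1 S n i t).length = t.length + 1 := by
  rw [G1, List.length_take, List.length_append, List.length_cons]
  omega

variable {S}

/-- On genuine seeds the clamp is transparent: `G1 S n i t = S⟨1ⁿ, ⟨1ⁱ, t⟩⟩` for `|t| = a(n)`. [folklore] -/
theorem G1_eq_of_length {a : Polynomial ℕ} (hb : HasOutLenI S a fun n => a.eval n + 1) {n i : ℕ}
    {t : List Bool} (ht : t.length = a.eval n) : G1 S n i t = atLevelI S n i t := by
  have hl : (atLevelI S n i t).length = t.length + 1 := by rw [ht]; exact hb n i t ht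
  rw [G1, List.take_append_of_le_length hl.ge, List.take_of_length_le hl.le]

variable (S)

/-! ### The stretched indexed sampler -/

/-- **The stretched indexed sampler** (Construction 3.3.2 at level `n`, index `i`, `Lp(n)` rounds):
on `w = ⟨x, ⟨y, s⟩⟩` output `gen (G1 S |x| |y|) (Lp |x|) s`, i.e. on `⟨1ⁿ, ⟨1ⁱ, s⟩⟩` the first `Lp(n)`
bits generated from the seed `s` by iterating the candidate `G^{(n,i)}`.
[cite: Goldreich2001, Construction 3.3.2 (PDF p. 146)] -/
def genI (Lp : Polynomial ℕ) (w : List Bool) : List Bool :=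
  gen (G1 S (fstF w).length (fstF (sndF w)).length) (Lp.eval (fstF w).length) (sndF (sndF w))

/-- `|1ⁿ| = n`, `|ones i| = i`: the sampler read at level `n`, index `i`. [folklore] -/
theorem genI_atLevelI (Lp : Polynomial ℕ) (n i : ℕ) (s : List Bool) :
    atLevelI (genI S Lp) n i s = gen (G1 S n i) (Lp.eval n) s := by
  have h1 : (unaryEncodeNat n).length = n := unary_decode_encode_nat n
  simp only [atLevelI, genI, fstF_boolPair, sndF_boolPair, h1, ones, List.length_replicate]

/-- **Common output length `Lp(n)`** of the stretched sampler (for every index and every seed).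
[cite: Goldreich2001, Construction 3.3.2 (`|G(s)| = p(|s|)`)] -/
theorem hasOutLenI_genI (a Lp : Polynomial ℕ) : HasOutLenI (genI S Lp) a fun n => Lp.eval n := by
  intro n i s _
  have h := genI_atLevelI S Lp n i s
  simp only [atLevelI] at h
  rw [h]
  exact length_gen (ne_nil_of_length (length_G1 S n i)) _ _

/-! ### The machine of the stretched sampler: a clocked loop carrying the context `⟨1ⁿ, 1ⁱ⟩` -/

section Machine

/-- The query `⟨1^{|c₁|}, ⟨1^{|c₂|}, t⟩⟩` to `S` assembled from a context `c = ⟨c₁, c₂⟩` and a state `t`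
(inner state `y = ⟨c, ⟨acc, t⟩⟩`). [folklore] -/
noncomputable def ctxQryF (y : List Bool) : List Bool :=
  boolPair (onesFn (fstF (fstF y))) (boolPair (onesFn (sndF (fstF y))) (sndPow 1 y))

/-- The clamped step `G1` read off the inner state: `(S(query) · 1 · t) ↾ (|t| + 1)`. [folklore] -/
noncomputable def g1F (y : List Bool) : List Bool :=
  Plumb.takeFn (boolPair (onesFn (true :: sndPow 1 y)) (S (ctxQryF y) ++ (true :: sndPow 1 y)))

/-- One round on the inner state `⟨c, ⟨acc, t⟩⟩ ↦ ⟨c, ⟨acc · first(G1 t), suffix(G1 t)⟩⟩`. [folklore] -/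
noncomputable def roundI₀ (y : List Bool) : List Bool :=
  boolPair (fstF y) (boolPair (nthF 1 y ++ take1Fn (g1F S y)) (Plumb.dropFn (boolPair [true] (g1F S y))))

/-- One round on the full state `⟨clock, inner⟩`, clamped to additive growth `2`. [folklore] -/
noncomputable def roundI : List Bool → List Bool := clampAdd 2 (mapSndFn (roundI₀ S))

/-- The clocked loop `z ↦ roundI^{|clock z|} z`. [folklore] -/
noncomputable def loopI (z : List Bool) : List Bool :=
  (roundI S)^[(X : Polynomial ℕ).eval (boolUnpair z).1.length] z

/-- The whole pipeline: lay out `⟨1^{Lp|x|}, ⟨⟨x, y⟩, ⟨ε, s⟩⟩⟩` from `w = ⟨x, ⟨y, s⟩⟩`, run the loop, read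
the accumulator. [folklore] -/
noncomputable def genIFn (Lp : Polynomial ℕ) (w : List Bool) : List Bool :=
  nthF 2 (loopI S (boolPair (Plumb.polyFn Lp (fstF w))
    (boolPair (boolPair (fstF w) (fstF (sndF w))) (boolPair [] (sndF (sndF w))))))

variable {S}

/-- `ctxQryF ∈ FP`. [Arora–Barak 2009, §1.3] [folklore] -/
theorem ctxQryF_mem_FP : ctxQryF ∈ FP :=
  (pair_mem_FP (comp_mem_FP' onesFn_mem_FP (comp_mem_FP' fstF_mem_FP fstF_mem_FP))
    (pair_mem_FP (comp_mem_FP' onesFn_mem_FP (comp_mem_FP' sndF_mem_FP fstF_mem_FP)) (sndPow_mem_FP 1)) :)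

/-- `g1F S ∈ FP` for `S ∈ FP`. [Arora–Barak 2009, §1.3] [folklore] -/
theorem g1F_mem_FP (hS : S ∈ FP) : g1F S ∈ FP :=
  (comp_mem_FP' Plumb.takeFn_mem_FP (pair_mem_FP (comp_mem_FP' onesFn_mem_FP
    (comp_mem_FP' (cons_mem_FP true) (sndPow_mem_FP 1)))
    (append_mem_FP (comp_mem_FP' hS ctxQryF_mem_FP) (comp_mem_FP' (cons_mem_FP true) (sndPow_mem_FP 1)))) :)

/-- `roundI₀ S ∈ FP` for `S ∈ FP`. [Arora–Barak 2009, §1.3] [folklore] -/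
theorem roundI₀_mem_FP (hS : S ∈ FP) : roundI₀ S ∈ FP :=
  (pair_mem_FP fstF_mem_FP (pair_mem_FP (append_mem_FP (nthF_mem_FP 1) (comp_mem_FP' take1Fn_mem_FP (g1F_mem_FP hS)))
    (comp_mem_FP' Plumb.dropFn_mem_FP (pair_mem_FP (const_mem_FP _) (g1F_mem_FP hS)))) :)

/-- `roundI S ∈ FP` for `S ∈ FP`. [Arora–Barak 2009, §1.3] [folklore] -/
theorem roundI_mem_FP (hS : S ∈ FP) : roundI S ∈ FP :=
  clampAdd_mem_FP 2 (mapSndFn_mem_FP (roundI₀_mem_FP hS))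

/-- `loopI S ∈ FP` (`iterate_mem_FP`, additive growth `2`). [Arora–Barak 2009, §1.4.1] [cite: AroraBarak2009, §1.4.1] -/
theorem loopI_mem_FP (hS : S ∈ FP) : loopI S ∈ FP :=
  iterate_mem_FP (roundI_mem_FP hS) 2 (length_clampAdd_le 2 _) X

/-- `genIFn S Lp ∈ FP` for `S ∈ FP`. [Arora–Barak 2009, §1.3–1.4] [cite: AroraBarak2009, §1.4.1] -/
theorem genIFn_mem_FP (hS : S ∈ FP) (Lp : Polynomial ℕ) : genIFn S Lp ∈ FP :=
  (comp_mem_FP' (nthF_mem_FP 2) (comp_mem_FP' (loopI_mem_FP hS) (pair_mem_FP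
    (comp_mem_FP' (Plumb.polyFn_mem_FP Lp) fstF_mem_FP)
    (pair_mem_FP (pair_mem_FP fstF_mem_FP (comp_mem_FP' fstF_mem_FP sndF_mem_FP))
      (pair_mem_FP (const_mem_FP []) (comp_mem_FP' sndF_mem_FP sndF_mem_FP))))) :)

/-- Value of `g1F` on an inner state `⟨⟨c₁, c₂⟩, ⟨acc, t⟩⟩`: the clamped step `G1 S |c₁| |c₂| t`. [folklore] -/
theorem g1F_state (c₁ c₂ acc t : List Bool) :
    g1F S (boolPair (boolPair c₁ c₂) (boolPair acc t)) = G1 S c₁.length c₂.length t := by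
  have hq : ctxQryF (boolPair (boolPair c₁ c₂) (boolPair acc t)) =
      boolPair (unaryEncodeNat c₁.length) (boolPair (ones c₂.length) t) := by
    simp only [ctxQryF, fstF_boolPair, sndF_boolPair, sndPow_succ_boolPair, sndPow_zero_boolPair, onesFn,
      unaryEncodeNat_eq_replicate, ones]
  simp only [g1F, hq, sndPow_succ_boolPair, sndPow_zero_boolPair, Plumb.takeFn_boolPair, onesFn,
    unaryEncodeNat_eq_replicate, List.length_replicate, List.length_cons, G1, atLevelI, ones]

/-- **Value of one round** on a well-formed inner state. [folklore] -/
theorem roundI₀_state (c₁ c₂ acc t : List Bool) :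
    roundI₀ S (boolPair (boolPair c₁ c₂) (boolPair acc t)) =
      boolPair (boolPair c₁ c₂) (boolPair (acc ++ (G1 S c₁.length c₂.length t).take 1)
        ((G1 S c₁.length c₂.length t).drop 1)) := by
  simp only [roundI₀, g1F_state, fstF_boolPair, nthF_succ_boolPair, nthF_zero_boolPair, take1Fn,
    Plumb.dropFn_boolPair, List.length_singleton]

/-- **Value of one clamped round** on the full state (the clamp is transparent: growth exactly two). [folklore] -/
theorem roundI_state (u c₁ c₂ acc t : List Bool) :
    roundI S (boolPair u (boolPair (boolPair c₁ c₂) (boolPair acc t))) =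
      boolPair u (boolPair (boolPair c₁ c₂) (boolPair (acc ++ (G1 S c₁.length c₂.length t).take 1)
        ((G1 S c₁.length c₂.length t).drop 1))) := by
  have hval : mapSndFn (roundI₀ S) (boolPair u (boolPair (boolPair c₁ c₂) (boolPair acc t))) =
      boolPair u (boolPair (boolPair c₁ c₂) (boolPair (acc ++ (G1 S c₁.length c₂.length t).take 1)
        ((G1 S c₁.length c₂.length t).drop 1))) := by
    rw [mapSndFn_boolPair, roundI₀_state]
  rw [roundI, clampAdd_eq_of_le (by
    rw [hval]
    simp only [length_boolPair, List.length_append, List.length_take, List.length_drop, length_G1]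
    omega), hval]

/-- **`m` rounds generate `m` bits**: from `⟨u, ⟨c, ⟨acc, t⟩⟩⟩` the loop reaches
`⟨u, ⟨c, ⟨acc · gen m t, st m t⟩⟩⟩` (for the clamped step at the context's level and index).
[cite: Goldreich2001, Construction 3.3.2 (PDF p. 146)] -/
theorem iterate_roundI (u c₁ c₂ : List Bool) : ∀ (m : ℕ) (acc t : List Bool),
    (roundI S)^[m] (boolPair u (boolPair (boolPair c₁ c₂) (boolPair acc t))) =
      boolPair u (boolPair (boolPair c₁ c₂) (boolPair (acc ++ gen (G1 S c₁.length c₂.length) m t)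
        (st (G1 S c₁.length c₂.length) m t))) := by
  intro m
  induction m with
  | zero => intro acc t; simp
  | succ m ih =>
    intro acc t
    rw [Function.iterate_succ_apply, roundI_state, ih, gen_succ, st_succ, List.append_assoc]

/-- **Value of the loop**: `loopI S ⟨u, ⟨c, ⟨ε, t⟩⟩⟩ = ⟨u, ⟨c, ⟨gen |u| t, st |u| t⟩⟩⟩`. [folklore] -/
theorem loopI_boolPair (u c₁ c₂ t : List Bool) :
    loopI S (boolPair u (boolPair (boolPair c₁ c₂) (boolPair [] t))) =
      boolPair u (boolPair (boolPair c₁ c₂) (boolPair (gen (G1 S c₁.length c₂.length) u.length t)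
        (st (G1 S c₁.length c₂.length) u.length t))) := by
  unfold loopI
  rw [boolUnpair_boolPair, eval_X]
  have h := iterate_roundI (S := S) u c₁ c₂ u.length [] t
  rwa [List.nil_append] at h

/-- **The pipeline computes the stretched sampler** on every input. [cite: Goldreich2001, Construction 3.3.2 (PDF p. 146)] -/
theorem genIFn_apply (Lp : Polynomial ℕ) (w : List Bool) : genIFn S Lp w = genI S Lp w := by
  rw [genIFn, loopI_boolPair, nthF_succ_boolPair, nthF_succ_boolPair, nthF_zero_boolPair, Plumb.polyFn_apply,
    ones, List.length_replicate]
  rfl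

/-- **The stretched indexed sampler is in `FP`** for `S ∈ FP`.
[cite: Goldreich2001, Thm. 3.3.3 (proof: "G can be implemented in polynomial time")] -/
theorem genI_mem_FP (hS : S ∈ FP) (Lp : Polynomial ℕ) : genI S Lp ∈ FP := by
  have h : genI S Lp = genIFn S Lp := funext fun w => (genIFn_apply Lp w).symm
  rw [h]
  exact genIFn_mem_FP hS Lp

end Machine

/-! ### The reduction `D'` with three pieces of advice in its coin count -/

section Reduction

variable (Lp M : Polynomial ℕ) (D : RandAlg (List Bool) Bool)

/-- The position `k = |r| mod (Lp(n)+1)` (with `n = |x|`, `x` the first field of the game input). [folklore] -/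
def kOfI (inp r : List Bool) : ℕ := r.length % bmod Lp (boolUnpair inp).1.length

/-- The candidate index `i = (|r| / (Lp(n)+1)) mod (M(n)+1)`. [folklore] -/
def iOfI (inp r : List Bool) : ℕ := (r.length / bmod Lp (boolUnpair inp).1.length) % bmod M (boolUnpair inp).1.length

/-- The coin count `κ = (|r| / (Lp(n)+1)) / (M(n)+1)` of `D`. [folklore] -/
def kapOfI (inp r : List Bool) : ℕ := (r.length / bmod Lp (boolUnpair inp).1.length) / bmod M (boolUnpair inp).1.length

/-- The hybrid sample assembled by `D'`: `β · f_{Lp(n)-k}(α)` with `β` the first `k` coins and the suffix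
generated by the candidate of index `i`. [cite: Goldreich2001, Thm. 3.3.3 (proof, algorithm D')] -/
def redWordI (inp r : List Bool) : List Bool :=
  r.take (kOfI Lp inp r) ++ PRGStretch.ext (G1 S (boolUnpair inp).1.length (iOfI Lp M inp r))
    (Lp.eval (boolUnpair inp).1.length - kOfI Lp inp r - 1) (boolUnpair inp).2

/-- The coins handed to `D`: the `κ` coins after the first `k`. [folklore] -/
def redCoinsI (inp r : List Bool) : List Bool :=
  (r.drop (kOfI Lp inp r)).take (kapOfI Lp M inp r)

/-- **The run function of `D'`**: `D(⟨x, β · f_{Lp(|x|)-k}(α)⟩; ρ)` with `(k, i, κ)` decoded from `|r|`.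
[cite: Goldreich2001, Thm. 3.3.3 (proof, algorithm D')] -/
def redRunI (inp r : List Bool) : Bool :=
  D.run (boolPair (boolUnpair inp).1 (redWordI S Lp M inp r)) (redCoinsI Lp M inp r)

/-- **The reduction `D'`** with a prescribed coin budget `cl`. [cite: Goldreich2001, Thm. 3.3.3 (proof, algorithm D')] -/
def redI (cl : ℕ → ℕ) : RandAlg (List Bool) Bool where
  run := redRunI S Lp M D
  coinLen := cl

/-! #### The run function of `D'` is a pipeline of `FP` bricks -/

/-- `⟨1^{|r| / B₁}, 1^{|r| mod B₁}⟩`, `B₁ = Lp(|x|) + 1`, from the machine input `z = ⟨inp, r⟩`. [folklore] -/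
noncomputable def dm1F (z : List Bool) : List Bool :=
  Plumb.divModFn (boolPair (Plumb.polyFn (Lp + 1) (fstF (fstF z))) (onesFn (sndF z)))

/-- `⟨1^κ, 1ⁱ⟩`: the quotient of `dm1F` divided by `B₂ = M(|x|) + 1`. [folklore] -/
noncomputable def dm2F (z : List Bool) : List Bool :=
  Plumb.divModFn (boolPair (Plumb.polyFn (M + 1) (fstF (fstF z))) (fstF (dm1F Lp z)))

/-- `1ᵏ`. [folklore] -/
noncomputable def kOnesI (z : List Bool) : List Bool := sndF (dm1F Lp z)

/-- `1ⁱ`. [folklore] -/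
noncomputable def iOnesI (z : List Bool) : List Bool := sndF (dm2F Lp M z)

/-- `1^κ`. [folklore] -/
noncomputable def kapOnesI (z : List Bool) : List Bool := fstF (dm2F Lp M z)

/-- `β = r ↾ k`. [folklore] -/
noncomputable def betaI (z : List Bool) : List Bool := Plumb.takeFn (boolPair (kOnesI Lp z) (sndF z))

/-- `ρ` = the `κ` coins after the first `k`. [folklore] -/
noncomputable def rhoI (z : List Bool) : List Bool :=
  Plumb.takeFn (boolPair (kapOnesI Lp M z) (Plumb.dropFn (boolPair (kOnesI Lp z) (sndF z))))

/-- The loop count `1^{Lp(|x|) - k - 1}`. [folklore] -/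
noncomputable def cntI (z : List Bool) : List Bool :=
  Plumb.dropFn (boolPair (true :: kOnesI Lp z) (Plumb.polyFn Lp (fstF (fstF z))))

/-- The generated suffix `gen (Lp(|x|) - k - 1) (suffix α)` by the candidate of index `i` (the loop of
Construction 3.3.2 with context `⟨x, 1ⁱ⟩`). [folklore] -/
noncomputable def genRI (z : List Bool) : List Bool :=
  nthF 2 (loopI S (boolPair (cntI Lp z) (boolPair (boolPair (fstF (fstF z)) (iOnesI Lp M z))
    (boolPair [] (Plumb.dropFn (boolPair [true] (sndF (fstF z))))))))

/-- The whole preprocessing `⟨inp, r⟩ ↦ ⟨⟨x, β · f(α)⟩, ρ⟩` in front of the machine of `D`. [folklore] -/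
noncomputable def preI (z : List Bool) : List Bool :=
  boolPair (boolPair (fstF (fstF z)) (betaI Lp z ++ (take1Fn (sndF (fstF z)) ++ genRI S Lp M z))) (rhoI Lp M z)

variable {S Lp M D}

/-- `dm1F ∈ FP`. [folklore] -/
theorem dm1F_mem_FP : dm1F Lp ∈ FP :=
  (comp_mem_FP' Plumb.divModFn_mem_FP (pair_mem_FP (comp_mem_FP' (Plumb.polyFn_mem_FP (Lp + 1))
    (comp_mem_FP' fstF_mem_FP fstF_mem_FP)) (comp_mem_FP' onesFn_mem_FP sndF_mem_FP)) :)

/-- `dm2F ∈ FP`. [folklore] -/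
theorem dm2F_mem_FP : dm2F Lp M ∈ FP :=
  (comp_mem_FP' Plumb.divModFn_mem_FP (pair_mem_FP (comp_mem_FP' (Plumb.polyFn_mem_FP (M + 1))
    (comp_mem_FP' fstF_mem_FP fstF_mem_FP)) (comp_mem_FP' fstF_mem_FP (dm1F_mem_FP (Lp := Lp)))) :)

/-- `kOnesI ∈ FP`. [folklore] -/
theorem kOnesI_mem_FP : kOnesI Lp ∈ FP := (comp_mem_FP' sndF_mem_FP (dm1F_mem_FP (Lp := Lp)) :)

/-- `iOnesI ∈ FP`. [folklore] -/
theorem iOnesI_mem_FP : iOnesI Lp M ∈ FP := (comp_mem_FP' sndF_mem_FP (dm2F_mem_FP (Lp := Lp) (M := M)) :)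

/-- `kapOnesI ∈ FP`. [folklore] -/
theorem kapOnesI_mem_FP : kapOnesI Lp M ∈ FP := (comp_mem_FP' fstF_mem_FP (dm2F_mem_FP (Lp := Lp) (M := M)) :)

/-- `betaI ∈ FP`. [folklore] -/
theorem betaI_mem_FP : betaI Lp ∈ FP :=
  (comp_mem_FP' Plumb.takeFn_mem_FP (pair_mem_FP (kOnesI_mem_FP (Lp := Lp)) sndF_mem_FP) :)

/-- `rhoI ∈ FP`. [folklore] -/
theorem rhoI_mem_FP : rhoI Lp M ∈ FP :=
  (comp_mem_FP' Plumb.takeFn_mem_FP (pair_mem_FP (kapOnesI_mem_FP (Lp := Lp) (M := M))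
    (comp_mem_FP' Plumb.dropFn_mem_FP (pair_mem_FP (kOnesI_mem_FP (Lp := Lp)) sndF_mem_FP))) :)

/-- `cntI ∈ FP`. [folklore] -/
theorem cntI_mem_FP : cntI Lp ∈ FP :=
  (comp_mem_FP' Plumb.dropFn_mem_FP (pair_mem_FP (comp_mem_FP' (cons_mem_FP true) (kOnesI_mem_FP (Lp := Lp)))
    (comp_mem_FP' (Plumb.polyFn_mem_FP Lp) (comp_mem_FP' fstF_mem_FP fstF_mem_FP))) :)

/-- `genRI ∈ FP`. [folklore] -/
theorem genRI_mem_FP (hS : S ∈ FP) : genRI S Lp M ∈ FP :=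
  (comp_mem_FP' (nthF_mem_FP 2) (comp_mem_FP' (loopI_mem_FP hS) (pair_mem_FP (cntI_mem_FP (Lp := Lp))
    (pair_mem_FP (pair_mem_FP (comp_mem_FP' fstF_mem_FP fstF_mem_FP) (iOnesI_mem_FP (Lp := Lp) (M := M)))
      (pair_mem_FP (const_mem_FP []) (comp_mem_FP' Plumb.dropFn_mem_FP
        (pair_mem_FP (const_mem_FP [true]) (comp_mem_FP' sndF_mem_FP fstF_mem_FP))))))) :)

/-- **The preprocessing is in `FP`.** [Arora–Barak 2009, §1.3–1.4] [cite: AroraBarak2009, §1.3] -/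
theorem preI_mem_FP (hS : S ∈ FP) : preI S Lp M ∈ FP :=
  (pair_mem_FP (pair_mem_FP (comp_mem_FP' fstF_mem_FP fstF_mem_FP)
    (append_mem_FP (betaI_mem_FP (Lp := Lp)) (append_mem_FP (comp_mem_FP' take1Fn_mem_FP (comp_mem_FP' sndF_mem_FP fstF_mem_FP))
      (genRI_mem_FP (Lp := Lp) (M := M) hS)))) (rhoI_mem_FP (Lp := Lp) (M := M)) :)

/-- Value of `dm1F` on a machine input. [folklore] -/
theorem dm1F_boolPair (inp r : List Bool) :
    dm1F Lp (boolPair inp r) =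
      boolPair (ones (r.length / bmod Lp (boolUnpair inp).1.length)) (ones (kOfI Lp inp r)) := by
  simp only [dm1F, fstF_boolPair, sndF_boolPair, Plumb.polyFn_apply, onesFn, unaryEncodeNat_eq_replicate,
    eval_add, eval_one]
  rw [← ones, Plumb.divModFn_boolPair]
  rfl

/-- Value of `dm2F` on a machine input. [folklore] -/
theorem dm2F_boolPair (inp r : List Bool) :
    dm2F Lp M (boolPair inp r) = boolPair (ones (kapOfI Lp M inp r)) (ones (iOfI Lp M inp r)) := by
  rw [dm2F, dm1F_boolPair, fstF_boolPair, fstF_boolPair, Plumb.polyFn_apply, eval_add, eval_one,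
    Plumb.divModFn_boolPair]
  rfl

/-- Value of `kOnesI`. [folklore] -/
theorem kOnesI_boolPair (inp r : List Bool) : kOnesI Lp (boolPair inp r) = ones (kOfI Lp inp r) := by
  rw [kOnesI, dm1F_boolPair, sndF_boolPair]

/-- Value of `iOnesI`. [folklore] -/
theorem iOnesI_boolPair (inp r : List Bool) : iOnesI Lp M (boolPair inp r) = ones (iOfI Lp M inp r) := by
  rw [iOnesI, dm2F_boolPair, sndF_boolPair]

/-- Value of `kapOnesI`. [folklore] -/
theorem kapOnesI_boolPair (inp r : List Bool) : kapOnesI Lp M (boolPair inp r) = ones (kapOfI Lp M inp r) := by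
  rw [kapOnesI, dm2F_boolPair, fstF_boolPair]

/-- Value of `betaI`: the first `k` coins. [folklore] -/
theorem betaI_boolPair (inp r : List Bool) : betaI Lp (boolPair inp r) = r.take (kOfI Lp inp r) := by
  rw [betaI, kOnesI_boolPair, sndF_boolPair, Plumb.takeFn_boolPair, List.length_replicate]

/-- Value of `rhoI`: the coins of `D`. [folklore] -/
theorem rhoI_boolPair (inp r : List Bool) : rhoI Lp M (boolPair inp r) = redCoinsI Lp M inp r := by
  rw [rhoI, kapOnesI_boolPair, kOnesI_boolPair, sndF_boolPair, Plumb.dropFn_boolPair, Plumb.takeFn_boolPair,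
    List.length_replicate, List.length_replicate, redCoinsI]

/-- Value of `cntI`: `1^{Lp(|x|) - k - 1}`. [folklore] -/
theorem cntI_boolPair (inp r : List Bool) :
    cntI Lp (boolPair inp r) = ones (Lp.eval (boolUnpair inp).1.length - kOfI Lp inp r - 1) := by
  rw [cntI, kOnesI_boolPair, fstF_boolPair, Plumb.dropFn_boolPair, Plumb.polyFn_apply, List.length_cons,
    List.length_replicate, ones, ones, List.drop_replicate, Nat.sub_sub]
  rfl

/-- Value of `genRI`: the generated suffix, by the candidate of the decoded index. [folklore] -/
theorem genRI_boolPair (inp r : List Bool) :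
    genRI S Lp M (boolPair inp r) =
      gen (G1 S (boolUnpair inp).1.length (iOfI Lp M inp r))
        (Lp.eval (boolUnpair inp).1.length - kOfI Lp inp r - 1) ((boolUnpair inp).2.drop 1) := by
  rw [genRI, cntI_boolPair, iOnesI_boolPair, fstF_boolPair, Plumb.dropFn_boolPair,
    loopI_boolPair, nthF_succ_boolPair, nthF_succ_boolPair, nthF_zero_boolPair]
  simp only [ones, List.length_replicate, List.length_singleton]
  rfl

/-- **Value of the preprocessing**: `preI ⟨inp, r⟩ = ⟨⟨x, β · f_{Lp(|x|)-k}(α)⟩, ρ⟩`, on EVERY machine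
input (ill-formed `inp` included, read through `boolUnpair`). [folklore] -/
theorem preI_boolPair (inp r : List Bool) :
    preI S Lp M (boolPair inp r) =
      boolPair (boolPair (boolUnpair inp).1 (redWordI S Lp M inp r)) (redCoinsI Lp M inp r) := by
  rw [preI, betaI_boolPair, rhoI_boolPair, genRI_boolPair, fstF_boolPair]
  rfl

/-- **`D'` is PPT** when `D` is PPT, `S ∈ FP` and the coin budget is polynomially bounded.
[cite: Goldreich2001, Thm. 3.3.3 (proof: "Clearly, D' can be implemented in probabilistic polynomial time")] -/
theorem isPPT_redI (hD : IsPPT D encodeBool) (hS : S ∈ FP) {cl : ℕ → ℕ}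
    (hcl : ∃ q : Polynomial ℕ, ∀ L, cl L ≤ q.eval L) : IsPPT (redI S Lp M D cl) encodeBool := by
  refine ⟨?_, hcl⟩
  have hpre : PolyTimeComputable (fun p : List Bool × List Bool => boolPair (id p.1) p.2)
      (fun p : List Bool × List Bool => boolPair (id p.1) p.2)
      (fun p : List Bool × List Bool =>
        (boolPair (boolUnpair p.1).1 (redWordI S Lp M p.1 p.2), redCoinsI Lp M p.1 p.2)) :=
    (preI_mem_FP (Lp := Lp) (M := M) hS).of_comp_encode (fun p => boolPair p.1 p.2) (fun _ => rfl)
      (fun p => by simpa using (preI_boolPair (S := S) (Lp := Lp) (M := M) p.1 p.2).symm)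
  exact PolyTimeComputable.comp_holds hD.1 hpre

/-! #### The laws of `D'` -/

/-- **The output law of `D'` on `⟨1ⁿ, α⟩`** (`|α| = a + 1` for the seed length `a`, position `k < Lp n`,
index `i ≤ M n`, and the coin budget at this input length equal to `k + (Lp n + 1)·(i + (M n + 1)·κ)` with
`κ` the coin count of `D` on `Lp(n)`-bit samples): draw `β ← U_k` and run `D` on
`⟨1ⁿ, β · f_{Lp(n)-k}(α)⟩` built with the candidate `G1 S n i`.
[cite: Goldreich2001, Thm. 3.3.3 (proof, Claim 3.3.3.2: "By construction of D'")] -/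
theorem outputPMF_redI {cl : ℕ → ℕ} {n k i a : ℕ} (hk : k < Lp.eval n) (hi : i ≤ M.eval n)
    {α : List Bool} (hα : α.length = a + 1)
    (hcl : cl (2 * n + 2 + (a + 1)) = k + bmod Lp n * (i + bmod M n * D.coinLen (2 * n + 2 + Lp.eval n))) :
    (redI S Lp M D cl).outputPMF id (boolPair (unaryEncodeNat n) α) =
      (uniformBits k).bind fun b =>
        D.outputPMF id (boolPair (unaryEncodeNat n) (b ++ PRGStretch.ext (G1 S n i) (Lp.eval n - k - 1) α)) := by
  have hn : (unaryEncodeNat n).length = n := unary_decode_encode_nat n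
  have hαne : α ≠ [] := by intro h; rw [h] at hα; exact Nat.succ_ne_zero _ hα.symm
  have hkB : k < bmod Lp n := by unfold bmod; omega
  have hiB : i < bmod M n := by unfold bmod; omega
  have hB1 : 0 < bmod Lp n := by unfold bmod; omega
  have hB2 : 0 < bmod M n := by unfold bmod; omega
  set κ := D.coinLen (2 * n + 2 + Lp.eval n) with hκ
  have hL : (boolPair (unaryEncodeNat n) α).length = 2 * n + 2 + (a + 1) := by
    rw [length_boolPair, hn, hα]
  have hx : (boolUnpair (boolPair (unaryEncodeNat n) α)).1 = unaryEncodeNat n := by rw [boolUnpair_boolPair]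
  have hα' : (boolUnpair (boolPair (unaryEncodeNat n) α)).2 = α := by rw [boolUnpair_boolPair]
  -- decoding the advice from a coin string of the prescribed length
  have hdec : ∀ r : List Bool, r.length = k + bmod Lp n * (i + bmod M n * κ) →
      kOfI Lp (boolPair (unaryEncodeNat n) α) r = k ∧ iOfI Lp M (boolPair (unaryEncodeNat n) α) r = i ∧
        kapOfI Lp M (boolPair (unaryEncodeNat n) α) r = κ := by
    intro r hr
    have hq : r.length / bmod Lp n = i + bmod M n * κ := by
      rw [hr, Nat.add_mul_div_left _ _ hB1, Nat.div_eq_of_lt hkB, Nat.zero_add]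
    refine ⟨?_, ?_, ?_⟩
    · rw [kOfI, hx, hn, hr, Nat.add_mul_mod_self_left, Nat.mod_eq_of_lt hkB]
    · rw [iOfI, hx, hn, hq, Nat.add_mul_mod_self_left, Nat.mod_eq_of_lt hiB]
    · rw [kapOfI, hx, hn, hq, Nat.add_mul_div_left _ _ hB2, Nat.div_eq_of_lt hiB, Nat.zero_add]
  have hrun : ∀ r : List Bool, r.length = k + bmod Lp n * (i + bmod M n * κ) →
      (redI S Lp M D cl).run (boolPair (unaryEncodeNat n) α) r =
        D.run (boolPair (unaryEncodeNat n) (r.take k ++ PRGStretch.ext (G1 S n i) (Lp.eval n - k - 1) α))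
          ((r.drop k).take κ) := by
    intro r hr
    obtain ⟨h1, h2, h3⟩ := hdec r hr
    show redRunI S Lp M D _ r = _
    rw [redRunI, redWordI, redCoinsI, h1, h2, h3, hx, hα', hn]
  -- the packed budget splits as `k + (κ + e)`
  obtain ⟨e, he⟩ : ∃ e, k + bmod Lp n * (i + bmod M n * κ) = k + (κ + e) := by
    have h1 : κ ≤ bmod Lp n * (i + bmod M n * κ) := by
      calc κ = 1 * (0 + 1 * κ) := by ring
        _ ≤ bmod Lp n * (i + bmod M n * κ) :=
            Nat.mul_le_mul hB1 (Nat.add_le_add (Nat.zero_le _) (Nat.mul_le_mul_right _ hB2))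
    exact ⟨bmod Lp n * (i + bmod M n * κ) - κ, by omega⟩
  rw [outputPMF_eq_map_uniformBits]
  have hcoin : (redI S Lp M D cl).coinLen (boolPair (unaryEncodeNat n) α).length = k + (κ + e) := by
    show cl _ = _
    rw [hL, hcl, ← he]
  rw [hcoin]
  have hmap : (uniformBits (k + (κ + e))).map (fun r => (redI S Lp M D cl).run (boolPair (unaryEncodeNat n) α) r) =
      (uniformBits (k + (κ + e))).map fun r =>
        D.run (boolPair (unaryEncodeNat n) (r.take k ++ PRGStretch.ext (G1 S n i) (Lp.eval n - k - 1) α))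
          ((r.drop k).take κ) := by
    change (uniformBits _).bind _ = (uniformBits _).bind _
    refine pmf_bind_congr_of_mem_support _ fun r hr => ?_
    have hrl := length_eq_of_mem_support_uniformBits hr
    simp only [Function.comp_apply]
    rw [hrun r (by rw [hrl, he])]
  rw [hmap, uniformBits_map_split k κ e fun b ρ =>
    D.run (boolPair (unaryEncodeNat n) (b ++ PRGStretch.ext (G1 S n i) (Lp.eval n - k - 1) α)) ρ]
  refine pmf_bind_congr_of_mem_support _ fun b hb => ?_
  have hbl : b.length = k := length_eq_of_mem_support_uniformBits hb
  have hc : D.coinLen (boolPair (unaryEncodeNat n)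
      (b ++ PRGStretch.ext (G1 S n i) (Lp.eval n - k - 1) α)).length = κ := by
    rw [length_boolPair, hn, List.length_append, hbl, length_ext (fun t => length_G1 S n i t) _ hαne, hκ]
    congr 1
    omega
  rw [outputPMF_eq_map_uniformBits, hc]

/-- **`D'` on an ensemble versus `D` on the assembled hybrid**: if every sample of `X` has length `a + 1`,
then `Pr[D'(1ⁿ, X) = 1] = Pr[D(1ⁿ, U_k · f(X)) = 1]`. [cite: Goldreich2001, Thm. 3.3.3 (proof, Claim 3.3.3.2)] -/
theorem acceptPMF_redI {cl : ℕ → ℕ} {n k i a : ℕ} (hk : k < Lp.eval n) (hi : i ≤ M.eval n)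
    (hcl : cl (2 * n + 2 + (a + 1)) = k + bmod Lp n * (i + bmod M n * D.coinLen (2 * n + 2 + Lp.eval n)))
    (X : PMF (List Bool)) (hX : ∀ α ∈ X.support, α.length = a + 1) :
    acceptPMF (redI S Lp M D cl) n X =
      acceptPMF D n ((uniformBits k).bind fun b =>
        (X.map (PRGStretch.ext (G1 S n i) (Lp.eval n - k - 1))).map fun e => b ++ e) := by
  rw [acceptPMF, acceptPMF]
  have h1 : (X.bind fun α => (redI S Lp M D cl).outputPMF id (boolPair (unaryEncodeNat n) α)) =
      X.bind fun α => (uniformBits k).bind fun b =>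
        D.outputPMF id (boolPair (unaryEncodeNat n) (b ++ PRGStretch.ext (G1 S n i) (Lp.eval n - k - 1) α)) :=
    pmf_bind_congr_of_mem_support X fun α hα => outputPMF_redI hk hi (hX α hα) hcl
  rw [h1, PMF.bind_comm, PMF.bind_bind]
  refine congrArg _ (funext fun b => ?_)
  rw [PMF.bind_map, PMF.bind_map]
  rfl

/-- **Claims 3.3.3.1–2, candidate side**: with position `k < Lp n` and index `i`, `D'` on `G^{(n,i)}(U_a)` —
read as the clamped `G1 S n i` — accepts with exactly the probability of `D` on the hybrid `H^k`.
[cite: Goldreich2001, Thm. 3.3.3 (proof, Claims 3.3.3.1–3.3.3.2)] -/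
theorem acceptPMF_redI_map {cl : ℕ → ℕ} {n k i a : ℕ} (hk : k < Lp.eval n) (hi : i ≤ M.eval n)
    (hcl : cl (2 * n + 2 + (a + 1)) = k + bmod Lp n * (i + bmod M n * D.coinLen (2 * n + 2 + Lp.eval n))) :
    acceptPMF (redI S Lp M D cl) n ((uniformBits a).map (G1 S n i)) =
      acceptPMF D n (hyb (G1 S n i) a (Lp.eval n) k) := by
  rw [acceptPMF_redI hk hi hcl _ fun α hα => ?_, hyb_eq_of_lt (G1 S n i) hk]
  · congr 1
    refine congrArg _ (funext fun b => ?_)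
    rw [PMF.map_comp, PMF.map_comp]
    rfl
  · obtain ⟨t, ht, rfl⟩ := (PMF.mem_support_map_iff _ _ _).1 hα
    rw [length_G1, length_eq_of_mem_support_uniformBits ht]

/-- **Claims 3.3.3.1–2, uniform side**: with position `k < Lp n`, `D'` on `U_{a+1}` accepts with exactly the
probability of `D` on the hybrid `H^{k+1}`. [cite: Goldreich2001, Thm. 3.3.3 (proof, Claims 3.3.3.1–3.3.3.2)] -/
theorem acceptPMF_redI_uniform {cl : ℕ → ℕ} {n k i a : ℕ} (hk : k < Lp.eval n) (hi : i ≤ M.eval n)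
    (hcl : cl (2 * n + 2 + (a + 1)) = k + bmod Lp n * (i + bmod M n * D.coinLen (2 * n + 2 + Lp.eval n))) :
    acceptPMF (redI S Lp M D cl) n (uniformBits (a + 1)) = acceptPMF D n (hyb (G1 S n i) a (Lp.eval n) (k + 1)) := by
  rw [acceptPMF_redI hk hi hcl _ fun α hα => length_eq_of_mem_support_uniformBits hα]
  congr 1
  have hE : (uniformBits (a + 1)).map (PRGStretch.ext (G1 S n i) (Lp.eval n - k - 1)) =
      (uniformBits 1).bind fun c => (uniformBits a).map fun t => c ++ gen (G1 S n i) (Lp.eval n - k - 1) t := by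
    rw [uniformBits_succ_eq_bind, PMF.map_bind]
    refine pmf_bind_congr_of_mem_support _ fun c hc => ?_
    have hcl' : c.length = 1 := length_eq_of_mem_support_uniformBits hc
    rw [PMF.map_comp]
    refine congrArg (fun f => (uniformBits a).map f) (funext fun t => ?_)
    simp only [Function.comp_apply, PRGStretch.ext]
    rw [List.take_append_of_le_length hcl'.ge, List.take_of_length_le hcl'.le,
      List.drop_append_of_le_length hcl'.ge, List.drop_of_length_le hcl'.le, List.nil_append]
  rw [hE, hyb, ← uniformBits_add k 1, PMF.bind_bind]
  refine congrArg _ (funext fun b => ?_)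
  rw [PMF.map_bind, PMF.bind_map]
  refine congrArg _ (funext fun c => ?_)
  simp only [Function.comp_apply, PMF.map_comp]
  refine congrArg (fun f => (uniformBits a).map f) (funext fun t => ?_)
  simp only [Function.comp_apply, List.append_assoc, Nat.sub_sub]

end Reduction

/-! ### The hybrids at a level: endpoints, the pigeonhole position, the budget -/

section Level

variable {S} {a : Polynomial ℕ} (Lp M : Polynomial ℕ) (D : RandAlg (List Bool) Bool) (k₀ : ℕ → ℕ)

/-- `p_n(k) = Pr[D(1ⁿ, H^k) = 1]` for the hybrids of the candidate `k₀(n)` at level `n` (seed length `a(n)`,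
`Lp(n)` output bits). [cite: Goldreich2001, Thm. 3.3.3 (proof: the hybrids H^k_n)] -/
noncomputable def pH (a : Polynomial ℕ) (n k : ℕ) : ℝ :=
  (acceptPMF D n (hyb (G1 S n (k₀ n)) (a.eval n) (Lp.eval n) k) true).toReal

/-- **The attacked position** at level `n`: a maximiser of the gap between neighbouring hybrids (any
position if `Lp n = 0`). [cite: Goldreich2001, Thm. 3.3.3 (proof: Δ(n)/p(n))] -/
noncomputable def kStarI (a : Polynomial ℕ) (n : ℕ) : ℕ :=
  if h : 0 < Lp.eval n then Classical.choose (exists_gap_ge (pH (S := S) Lp D k₀ a n) h) else 0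

/-- The attacked position is below `Lp n` and its gap dominates `Δ(n)/Lp(n)`. [cite: Goldreich2001, Thm. 3.3.3 (proof)] -/
theorem kStarI_spec {n : ℕ} (h : 0 < Lp.eval n) :
    kStarI (S := S) Lp D k₀ a n < Lp.eval n ∧
      |pH (S := S) Lp D k₀ a n 0 - pH (S := S) Lp D k₀ a n (Lp.eval n)| ≤
        Lp.eval n * |pH (S := S) Lp D k₀ a n (kStarI (S := S) Lp D k₀ a n) -
          pH (S := S) Lp D k₀ a n (kStarI (S := S) Lp D k₀ a n + 1)| := by
  rw [kStarI, dif_pos h]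
  exact Classical.choose_spec (exists_gap_ge (pH (S := S) Lp D k₀ a n) h)

/-- The game-input length at level `n`: `|⟨1ⁿ, α⟩| = 2n + 2 + (a(n) + 1)`. [folklore] -/
def lenI (a : Polynomial ℕ) (n : ℕ) : ℕ := 2 * n + 2 + (a.eval n + 1)

/-- The game-input length is strictly increasing in the level (so the level is determined by it). [folklore] -/
theorem strictMono_lenI (a : Polynomial ℕ) : StrictMono (lenI a) := by
  refine strictMono_nat_of_lt_succ fun n => ?_
  unfold lenI
  have : a.eval n ≤ a.eval (n + 1) := polynomial_eval_mono a (Nat.le_add_right n 1)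
  omega

/-- **The coin budget of `D'`**: at the game-input length of level `n`, the packed advice
`k*(n) + (Lp n + 1)·(k₀ n + (M n + 1)·κ(n))`; `0` at lengths attained by no level. [folklore] -/
noncomputable def clI (a : Polynomial ℕ) (L : ℕ) : ℕ :=
  open scoped Classical in
  if h : ∃ n, lenI a n = L then
    kStarI (S := S) Lp D k₀ a (Classical.choose h) +
      bmod Lp (Classical.choose h) * (k₀ (Classical.choose h) +
        bmod M (Classical.choose h) * D.coinLen (2 * Classical.choose h + 2 + Lp.eval (Classical.choose h)))
  else 0

/-- The budget at the game-input length of level `n`. [folklore] -/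
theorem clI_lenI (n : ℕ) :
    clI (S := S) Lp M D k₀ a (lenI a n) =
      kStarI (S := S) Lp D k₀ a n + bmod Lp n * (k₀ n + bmod M n * D.coinLen (2 * n + 2 + Lp.eval n)) := by
  classical
  have h : ∃ n', lenI a n' = lenI a n := ⟨n, rfl⟩
  have hn : Classical.choose h = n := (strictMono_lenI a).injective (Classical.choose_spec h)
  rw [clI, dif_pos h, hn]

/-- **The budget is polynomially bounded** (for PPT `D` and polynomially bounded `k₀`). [Arora–Barak 2009, Def. 7.1] [folklore] -/
theorem clI_le (hD : IsPPT D encodeBool) (hk₀ : ∀ n, k₀ n ≤ M.eval n) :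
    ∃ q : Polynomial ℕ, ∀ L, clI (S := S) Lp M D k₀ a L ≤ q.eval L := by
  classical
  obtain ⟨p, hp⟩ := hD.2
  refine ⟨Lp + (Lp + 1) * (M + (M + 1) * p.comp (2 * X + 2 + Lp)), fun L => ?_⟩
  have hQ : ∀ x, (Lp + (Lp + 1) * (M + (M + 1) * p.comp (2 * X + 2 + Lp))).eval x =
      Lp.eval x + (Lp.eval x + 1) * (M.eval x + (M.eval x + 1) * p.eval (2 * x + 2 + Lp.eval x)) := by
    intro x
    simp only [eval_add, eval_mul, eval_comp, eval_ofNat, eval_X, eval_one]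
  rw [hQ]
  by_cases h : ∃ n, lenI a n = L
  · rw [clI, dif_pos h]
    have hspec := Classical.choose_spec h
    generalize Classical.choose h = n at hspec ⊢
    have hnL : n ≤ L := by unfold lenI at hspec; omega
    have h1 : kStarI (S := S) Lp D k₀ a n ≤ Lp.eval L := by
      by_cases hT : 0 < Lp.eval n
      · exact ((kStarI_spec Lp D k₀ hT).1.le).trans (polynomial_eval_mono Lp hnL)
      · rw [kStarI, dif_neg hT]; exact Nat.zero_le _
    have h2 : bmod Lp n ≤ Lp.eval L + 1 := by unfold bmod; have := polynomial_eval_mono Lp hnL; omega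
    have h3 : k₀ n ≤ M.eval L := (hk₀ n).trans (polynomial_eval_mono M hnL)
    have h4 : bmod M n ≤ M.eval L + 1 := by unfold bmod; have := polynomial_eval_mono M hnL; omega
    have h5 : D.coinLen (2 * n + 2 + Lp.eval n) ≤ p.eval (2 * L + 2 + Lp.eval L) :=
      (hp _).trans (polynomial_eval_mono p (by have := polynomial_eval_mono Lp hnL; omega))
    exact Nat.add_le_add h1 (Nat.mul_le_mul h2 (Nat.add_le_add h3 (Nat.mul_le_mul h4 h5)))
  · rw [clI, dif_neg h]
    exact Nat.zero_le _

/-- **The reduction of the proof** for the candidate sequence `k₀`: `D'` with the budget `clI`. [folklore] -/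
noncomputable def invI (a : Polynomial ℕ) : RandAlg (List Bool) Bool :=
  redI S Lp M D (clI (S := S) Lp M D k₀ a)

/-- The endpoint `H^0` is the stretched candidate on a uniform seed. [cite: Goldreich2001, Thm. 3.3.3 (proof: "H^0_n equals G(U_n)")] -/
theorem hyb_zero_gen (G : List Bool → List Bool) (s₀ T : ℕ) : hyb G s₀ T 0 = (uniformBits s₀).map (gen G T) := by
  rw [hyb, uniformBits_zero, PMF.pure_bind, Nat.sub_zero]
  rfl

variable (S) in
/-- The level-`n` law of the stretched sampler at index `k₀(n)` is `H^0`. [folklore] -/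
theorem seedEnsembleI_genI (n : ℕ) :
    seedEnsembleI (genI S Lp) a k₀ n = hyb (G1 S n (k₀ n)) (a.eval n) (Lp.eval n) 0 := by
  rw [hyb_zero_gen]
  unfold seedEnsembleI
  refine congrArg (fun f => (uniformBits (a.eval n)).map f) (funext fun s => ?_)
  exact genI_atLevelI S Lp n (k₀ n) s

variable (S) in
/-- The level-`n` law of the one-step candidate at index `k₀(n)` is the law of the clamped `G1`. [folklore] -/
theorem seedEnsembleI_eq_map_G1 (hb : HasOutLenI S a fun n => a.eval n + 1) (n : ℕ) :
    seedEnsembleI S a k₀ n = (uniformBits (a.eval n)).map (G1 S n (k₀ n)) := by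
  unfold seedEnsembleI
  change (uniformBits _).bind _ = (uniformBits _).bind _
  refine pmf_bind_congr_of_mem_support _ fun s hs => ?_
  simp only [Function.comp_apply]
  rw [G1_eq_of_length hb (length_eq_of_mem_support_uniformBits hs)]

/-- **The advantage of any PPT `D` against the stretched candidate sequence is at most `Lp(n)` times the
advantage of `D'` against the one-step candidate sequence, at every `n`.**
[cite: Goldreich2001, Thm. 3.3.3 (proof: "= Δ(n)/p(n)")] -/
theorem distAdvantage_le_mul_redI (hb : HasOutLenI S a fun n => a.eval n + 1) (hT : ∀ n, 0 < Lp.eval n)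
    (hk₀ : ∀ n, k₀ n ≤ M.eval n) (n : ℕ) :
    distAdvantage D (seedEnsembleI (genI S Lp) a k₀) (uniformEnsemble fun n => Lp.eval n) n ≤
      Lp.eval n * distAdvantage (invI (S := S) Lp M D k₀ a) (seedEnsembleI S a k₀)
        (uniformEnsemble fun n => a.eval n + 1) n := by
  obtain ⟨hk, hgap⟩ := kStarI_spec (S := S) Lp D k₀ (a := a) (hT n)
  have hcl := clI_lenI (S := S) Lp M D k₀ (a := a) n
  have hadv : distAdvantage D (seedEnsembleI (genI S Lp) a k₀) (uniformEnsemble fun n => Lp.eval n) n =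
      |pH (S := S) Lp D k₀ a n 0 - pH (S := S) Lp D k₀ a n (Lp.eval n)| := by
    rw [distAdvantage, seedEnsembleI_genI S Lp k₀ n, pH, pH, hyb_self]
    rfl
  have hred : distAdvantage (invI (S := S) Lp M D k₀ a) (seedEnsembleI S a k₀) (uniformEnsemble fun n => a.eval n + 1) n =
      |pH (S := S) Lp D k₀ a n (kStarI (S := S) Lp D k₀ a n) - pH (S := S) Lp D k₀ a n (kStarI (S := S) Lp D k₀ a n + 1)| := by
    rw [distAdvantage, seedEnsembleI_eq_map_G1 S k₀ hb n, pH, pH, invI,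
      ← acceptPMF_redI_map (S := S) hk (hk₀ n) hcl, ← acceptPMF_redI_uniform (S := S) hk (hk₀ n) hcl]
    rfl
  rw [hadv, hred]
  exact hgap

/-- **Thm. 3.3.3, indexed form.** Let `S ∈ FP` be an indexed sampler whose candidates stretch `a(n)`-bit
seeds by one bit at every level and index, `Lp` a positive polynomial, and `k₀` a polynomially bounded
sequence of indices. If the one-step candidate sequence `n ↦ S⟨1ⁿ, ⟨1^{k₀(n)}, U_{a(n)}⟩⟩` is pseudorandom
(against `U_{a(n)+1}`), then so is the stretched sequence `n ↦ genI⟨1ⁿ, ⟨1^{k₀(n)}, U_{a(n)}⟩⟩` (against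
`U_{Lp(n)}`). The index sequence need not be computable: it travels in the coin count of the reduction.
[cite: Goldreich2001, Thm. 3.3.3 (PDF pp. 146–149); HastadImpagliazzoLevinLuby1999, §4] -/
theorem isPseudorandom_genI (hS : S ∈ FP) (hb : HasOutLenI S a fun n => a.eval n + 1)
    (hT : ∀ n, 0 < Lp.eval n) (hk₀ : ∀ n, k₀ n ≤ M.eval n)
    (hps : IsPseudorandom (seedEnsembleI S a k₀) fun n => a.eval n + 1) :
    IsPseudorandom (seedEnsembleI (genI S Lp) a k₀) fun n => Lp.eval n := by
  intro D hD
  have hPPT : IsPPT (invI (S := S) Lp M D k₀ a) encodeBool := isPPT_redI hD hS (clI_le Lp M D k₀ hD hk₀)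
  have hdec := hps _ hPPT
  have hpoly := hdec.polynomial_mul (Lp.map (Nat.castRingHom ℝ))
  refine hpoly.trans_abs_le fun n => ?_
  have heval : (Lp.map (Nat.castRingHom ℝ)).eval (n : ℝ) = ((Lp.eval n : ℕ) : ℝ) := by
    rw [eval_map, eval₂_at_natCast, eq_natCast, Nat.cast_id]
  rw [heval, abs_of_nonneg (distAdvantage_nonneg _ _ _ _), abs_of_nonneg
    (mul_nonneg (Nat.cast_nonneg _) (distAdvantage_nonneg _ _ _ _))]
  exact distAdvantage_le_mul_redI Lp M D k₀ hb hT hk₀ n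

end Level

end PRGStretchI

end Literature.Computability.Cryptography
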